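import Summits.QuantumFields.YangMills.Theorems.PoincareLipschitzOrbitMinHolderRegularityOfImprove
import Summits.QuantumFields.YangMills.Theorems.PoincareLipschitzLinearTail
import HarnessLib

/-!
# Crux `HistoryTailL` (stmt-QuantumFields-19936) BY NAME, modulo {K1-exp, the organ `hImprove`, `MeanDeviationL`} — FILE K-3c of the K2 final knit

Cell `ym3-torus` (YM ladder rung R3 = continuum SU(2) Yang–Mills on T³ — a RUNG, NOT the Clay problem: not d = 4, not infinite volume, not a mass gap);
LEAD seat `ym-ust-19936-w1` g9.  Helper `--supports stmt-QuantumFields-19936`; THEOREMS ONLY.  The K2 DISPLAY OF RECORD ✓p700135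
(★w4 g12 `PoincareLipschitzLinear.historyTailL_of_expConcentration (hC : ⟨K1-exp⟩) (hLip : BlockLipschitzL) (hM : MeanDeviationL) : HistoryTailL`)
with its `hLip` binder — the route crux `PoincareLipschitz.BlockLipschitzL` (stmt-QuantumFields-23533) — REPLACED by the displayed classical statement
`hImprove` (v1, FROZEN 899858e5: «energy improvement at bounded normalised energy for locally minimising twisted `S³`-valued lattice maps on `ℤ³`
boxes») through K-3 ✓`PoincareLipschitzOrbitMinHolderRegularityOfImprove.blockLipschitzL_of_hImprove` (= K-1 ∘ K-2 ∘ face algebra ∘ ★w2 g11's face door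
✓p700641, with the [C]-socket discharged by ★w5 g12's ✓p705854).  So, BY KERNEL: `HistoryTailL ⟸ {K1-exp, hImprove, MeanDeviationL}` — two
displayed classical∕probabilistic statements (K1-exp: weak-coupling exponential concentration at the Hodge scale; `hImprove`: the K2 residue of record, NOT
in print even in the continuum without compactness, RULING g9-6 decomposes it as `hImproveCore ∧ hLogFreeDecay`) and one open route crux
(`MeanDeviationL`, stmt-QuantumFields-23083).  NOTHING of these three is proved here; `HistoryTailL` is NOT proved.

WHAT IS PROVED (ns `…Theorems.PoincareLipschitzHistoryTailOfImprove`).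
* ★★★ `historyTailL_of_hImprove (hK1 : ⟨K1-exp, ✓p700135's binder VERBATIM⟩) (hI : ⟨hImprove v1 VERBATIM⟩) (hM : Theses.PoincareLipschitz.MeanDeviationL) :
  Summit.QuantumFields.YangMills.Theses.UnitScaleTilt.HistoryTailL`.
HONEST SCOPE.  A three-line composition; YM₃ on T³ is rung R3, not Clay; YM gap NOT proved.

References: T. Bałaban, CMP 102 (1985) 255–275 [Balaban1985UV3] ((71) p.273: the large-field factors whose summability `HistoryTailL` asserts);
CMP 109 (1987) 249–301 [Balaban1987RG1] ((0.14) p.254); R. Schoen, K. Uhlenbeck, J. Diff. Geom. 17 (1982) 307–335 [SchoenUhlenbeck1982] (§4).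
-/

set_option autoImplicit false

noncomputable section

namespace Summit.QuantumFields.YangMills.Theorems.PoincareLipschitzHistoryTailOfImprove

open MeasureTheory
open scoped BigOperators
open Literature.MathematicalPhysics.QuantumFieldTheory.Balaban1983to89
open Literature.MathematicalPhysics.QuantumFieldTheory.Balaban1983to89.T3ContinuumYM3Torus
open Literature.MathematicalPhysics.QuantumFieldTheory.Balaban1983to89.T3UnitScaleTilt
open Literature.MathematicalPhysics.QuantumFieldTheory.Balaban1983to89.T3UnitLawDensityEML (ℰp)
open B4Eq19LatticeOperators (Zd box unitVec)
open Summit.QuantumFields.YangMills.Theorems.PoincareLipschitzLinear (historyTailL_of_expConcentration)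
open Summit.QuantumFields.YangMills.Theorems.PoincareLipschitzOrbitMinHolderRegularityOfImprove (blockLipschitzL_of_hImprove)

/-- ★★★ **THE CRUX `HistoryTailL` BY NAME FROM K1-exp, THE ORGAN `hImprove`, AND `MeanDeviationL`.**  ✓p700135's three-row display with its middle row
(`BlockLipschitzL`) supplied by K-3's `blockLipschitzL_of_hImprove`: Bałaban's UV-large-field histories are summably improbable under the Wilson–Gibbs law at every
free top fraction, GIVEN (K1-exp) weak-coupling exponential concentration of gauge-invariant Lipschitz box observables at the Hodge scale, (`hImprove`) energy
improvement at bounded normalised energy for twisted lattice minimisers into `S³`, and (`MeanDeviationL`) the first-moment bound on block-averaged plaquettes.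
[cite: Balaban1985UV3, (71) p.273; Balaban1987RG1, (0.14) p.254; SchoenUhlenbeck1982, §4] -/
theorem historyTailL_of_hImprove
    (hK1 : ∀ (L : ℕ), ∃ (Cc cc : ℝ), 0 ≤ Cc ∧ 0 < cc ∧ ∃ γ₁ : ℝ, 0 < γ₁ ∧ γ₁ ≤ 1 ∧
      ∀ (F : T3Family) (γ : ℝ), F.L = L → 0 < γ → γ ≤ γ₁ → ∀ (K n : ℕ), 1 ≤ n →
        (n : ℝ) ≤ (F.scheme ℰp γ).β K → 2 * n ≤ (F.P K).sitesPerDir 0 →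
        ∀ (x₀ : Site (F.P K) 0) (f : GaugeField (F.P K) 0 (Matrix.specialUnitaryGroup (Fin 2) ℂ) → ℝ) (Λ : ℝ), 0 < Λ →
          Measurable f → GaugeField.GaugeInvariant f →
          (∀ U U' : GaugeField (F.P K) 0 (Matrix.specialUnitaryGroup (Fin 2) ℂ),
            (∀ b : PBond (F.P K) 0, (∀ k, (b.src k - x₀ k).val < n) → (∀ k, (b.tgt k - x₀ k).val < n) → U b = U' b) →
              f U = f U') →
          (∀ U U' : GaugeField (F.P K) 0 (Matrix.specialUnitaryGroup (Fin 2) ℂ),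
            |f U - f U'| ≤ Λ * Real.sqrt (∑ b : PBond (F.P K) 0, GaugeGroup.dist1 (U b * (U' b)⁻¹) ^ 2)) →
          ∀ r : ℝ, 0 ≤ r →
            (gibbsK F ℰp γ K).real {U | r ≤ f U - ∫ V, f V ∂(gibbsK F ℰp γ K)} ≤
              Cc * Real.exp (-(cc * Real.sqrt ((F.scheme ℰp γ).β K) * r / ((n : ℝ) * Λ))))
    (hI : ∀ (Λ₀ ε₀ κ : ℝ), 0 < Λ₀ → 0 < ε₀ → 1 ≤ κ →
      ∃ (C₀ R₀ : ℝ), 1 ≤ C₀ ∧ 1 ≤ R₀ ∧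
      ∀ (u : Zd 3 → EuclideanSpace ℝ (Fin 4)) (τ : Fin 3 → Zd 3 → (EuclideanSpace ℝ (Fin 4) ≃ₗᵢ[ℝ] EuclideanSpace ℝ (Fin 4)))
      (z : Zd 3) (R : ℤ) (τ₀ : ℝ),
      R₀ ≤ R →
      (∀ y, ‖u y‖ = 1) →
      (∀ y ∈ box z (R + 1), ∀ (μ : Fin 3) (w : EuclideanSpace ℝ (Fin 4)), ‖τ μ y w - w‖ ≤ τ₀ * ‖w‖) →
      τ₀ * (R : ℝ) ≤ C₀⁻¹ →
      (∀ y ∈ box z R,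
      ‖∑ μ : Fin 3, (τ μ y (u (y + unitVec μ)) + (τ μ (y - unitVec μ)).symm (u (y - unitVec μ)))‖ • u y =
      ∑ μ : Fin 3, (τ μ y (u (y + unitVec μ)) + (τ μ (y - unitVec μ)).symm (u (y - unitVec μ)))) →
      (∀ (z' : Zd 3) (R' : ℤ), 0 ≤ R' → box z' (R' + 1) ⊆ box z R →
      ∀ v : Zd 3 → EuclideanSpace ℝ (Fin 4), (∀ y, y ∉ box z' R' → v y = u y) → (∀ y ∈ box z' R', ‖v y‖ = 1) →
      ∑ y ∈ box z' (R' + 1), ∑ μ : Fin 3, ‖τ μ y (u (y + unitVec μ)) - u y‖ ^ 2 ≤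
      ∑ y ∈ box z' (R' + 1), ∑ μ : Fin 3, ‖τ μ y (v (y + unitVec μ)) - v y‖ ^ 2) →
      (∑ y ∈ box z R, ∑ μ : Fin 3, ‖τ μ y (u (y + unitVec μ)) - u y‖ ^ 2 ≤ Λ₀ * R) →
      ∃ r : ℤ, 1 ≤ r ∧ (R : ℝ) ≤ C₀ * Real.log R ^ 6 * r ∧ κ * Real.log R ^ 6 * r ≤ R ∧
      box z (2 * r) ⊆ box z R ∧
      (∑ y ∈ box z (2 * r), ∑ μ : Fin 3, ‖τ μ y (u (y + unitVec μ)) - u y‖ ^ 2) * Real.log r ^ 6 ≤ ε₀ * r)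
    (hM : Summit.QuantumFields.YangMills.Theses.PoincareLipschitz.MeanDeviationL) :
    Summit.QuantumFields.YangMills.Theses.UnitScaleTilt.HistoryTailL :=
  historyTailL_of_expConcentration hK1 (blockLipschitzL_of_hImprove hI) hM

end Summit.QuantumFields.YangMills.Theorems.PoincareLipschitzHistoryTailOfImprove

end
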